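import Literature.Barriers.CriticalPhenomena.RigorousRGSmallParameterBinomialTestCalculus
import Literature.Barriers.CriticalPhenomena.RigorousRGSmallParameterLocalisationBoundOn
import Literature.Barriers.CriticalPhenomena.RigorousRGSmallParameterLocDuality
import HarnessLib

/-!
# `RigorousRGSmallParameter` (Slade, Theorem 1.4.1): [BS-rg-loc] Lemma 3.3.2 (lem:TayX) in lattice form
# — `|⟨F, f_m^{(a)}⟩_0| ≤ N‖F‖_{T_0(𝔥,R)}`, `N = C̄𝔥^{-p}R^{|α(m)|₁}` for boxes of radius `≍ R`

Companion ("proof architecture") file of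
`Literature/Barriers/CriticalPhenomena/RigorousRGSmallParameter.lean` (Loc norm-estimates layer,
[BS-rg-loc] Propositions 1.4.5–1.4.6). [BS-rg-loc] §2.2: "It is shown in Lemmas (lem:Pmbdpf) and
(lem:TayX) that `‖P̂_{m,0}‖_{T_0} ≤ R^{-|α(m)|₁}𝔥^m`, `‖f_{m'}^{(a)}‖_{Φ(U)} ≤ C̄𝔥^{-m'}R^{|α(m')|₁}`";
Lemma 3.3.2: "`‖f_m^{(a)}‖_{Φ(X)} ≤ C̄𝔥^{-m}R^{|α(m)|₁}`" for `j`-polymers `X` with `X_+` in a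
coordinate patch about `a`. With `…MonomialNorms` (Lemma 3.2.2) already landed, this file PROVES the
second estimate, combined with (e:FXbd) as it is used: for `F ∈ 𝒩(U)`, `U` inside a box of radius
`a₀` about `a`, **`|⟨F, f_m^{(a)}⟩_0| ≤ tayXConst · ‖F‖_{T_0(𝔥,R)}`** with the explicit
`tayXConst = 𝔥^{-p}(p!/N_m)Θ₁^{D}max(1, R/Θ₁ + 2R/w)^{p_Φ p}`, `Θ₁ = a₀ + p_Φ(w-1) + p_Φ + 2p_Φp + D`,
`D = |α(m)|₁` (so `N ≍ 𝔥^{-p}R^{|α(m)|₁}` when `a₀, w ≍ R`). The dual functions ((2.3), tree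
`…LocDuality.dualTF`) are `(p!/N_m)·indSeq_m(z)·∏_k ∏_j binom(z_j(x_k), α(m_k)_j)`; each lattice
difference lowers one binomial order (`…BinomialTestCalculus`), so on the box regions
`|∇^γ f_m^{(a)}(z)| ≤ (p!/N_m)(T + |γ| + D)^{D-|γ|}` (`0` beyond order `D`), which feeds the bounded
localisation bound `…LocalisationBoundOn.abs_TphiPairing_le_of_local'`. All PROVED, 0 sorry:

* `mbinom`, `mbinom_eq_coordProd`, `tot`, `le_tot`, **`abs_fdiffs_mbinom_le`**; `abs_slotProd_le_of`,
  `slotProd_eq_zero_of`, **`abs_napply_slotProd_mbinom_le`**;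
* `cntVec`, `cntAt`, `sum_count_eq_length`, `tot_cntVec`, `binomTF_apply`, `indSeq`
  (+`abs_indSeq_le_one`, `_eq_zero_of_length`, `_shiftAt`), **`tensorTF_map_binomTF`**,
  `napply_mul_invariant`, `dualConst` (+`_pos`), **`dualTF_eq`**, `dualTF_eq_zero_of_length`,
  `sum_tot_cntAt`;
* `dualBd` (+`_nonneg`, `_mono`), **`derivBdOn_dualTF`**, **`leibnizBd_dualBd_le`** (binomial
  theorem), `tayXConst`, **`abs_TphiPairing_dualTF_le`**.

Sources: D. C. Brydges, G. Slade, *A renormalisation group method. II. Approximation by local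
polynomials*, J. Stat. Phys. 159 (2015) 461–491, arXiv:1403.7253, §2.1 ((2.3)), §2.2 ((e:FXbd),
(e:PhatPhibd)), Lemma 3.3.2, TeX-source numbering.

## References

* [BrydgesSlade2015RGII] D. C. Brydges, G. Slade, *A renormalisation group method. II.
  Approximation by local polynomials*, J. Stat. Phys. **159** (2015) 461–491, arXiv:1403.7253.
-/

noncomputable section

namespace Literature.Barriers.CriticalPhenomena

namespace LongRangePhi4

namespace Loc

open Finset Tphi RGNorm LocalPoly Bump Polymer Literature.Probability.LatticeModels
open scoped ContDiff

variable {d M n : ℕ} [NeZero M]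

/-! ### Multi-binomials of the centred coordinates -/

/-- `x ↦ ∏_j binom(z_j(x), t_j)` around `a`. [cite: BrydgesSlade2015RGII, §2.1 (display (2.3))] -/
def mbinom (a : TorusSite d M) (t : Fin d → ℕ) : TorusSite d M → ℝ := fun x => ∏ j, chooseZ (t j) (coord a x j)

omit [NeZero M] in
/-- The multi-binomial is a coordinate product of lifted binomials. [folklore] -/
theorem mbinom_eq_coordProd (a : TorusSite d M) (t : Fin d → ℕ) :
    mbinom a t = coordProd fun j => liftM (a j) (chooseZ (t j)) := rfl

/-- The total order `|t|₁`. [folklore] -/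
def tot (t : Fin d → ℕ) : ℕ := ∑ j, t j

omit [NeZero M] in
/-- `t_j ≤ |t|₁`. [folklore] -/
theorem le_tot (t : Fin d → ℕ) (j : Fin d) : t j ≤ tot t :=
  Finset.single_le_sum (fun i _ => Nat.zero_le (t i)) (Finset.mem_univ j)

/-- **Differences of a multi-binomial on a box** (wrap-free: `(T + |L| + 1)·2 ≤ M`): for `x` with
`cycDist(a_j,x_j) ≤ T`, `|∇^L mbinom_t(x)| ≤ (T + |L| + |t|₁)^{|t|₁ ∸ |L|}`, and `∇^L mbinom_t(x) = 0` as
soon as some coordinate receives more differences than its order. [cite: BrydgesSlade2015RGII, Lemma 3.3.2 (lem:TayX)] -/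
theorem abs_fdiffs_mbinom_le (a : TorusSite d M) (t : Fin d → ℕ) {T : ℕ} (L : List (Fin d × Bool))
    (hM : ((T : ℤ) + L.length + 1) * 2 ≤ (M : ℤ)) (x : TorusSite d M) (hx : ∀ j, cycDist (a j) (x j) ≤ T) :
    |fdiffs (L.map (unitStep d M)) (mbinom a t) x| ≤ ((T : ℝ) + L.length + tot t) ^ (tot t - L.length) ∧
    ((∃ j, t j < (dirsAt j L).length) → fdiffs (L.map (unitStep d M)) (mbinom a t) x = 0) := by
  rw [mbinom_eq_coordProd, fdiffs_coordProd]
  unfold coordProd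
  set Θ : ℝ := (T : ℝ) + L.length + tot t with hΘ
  have hℓ : ∀ j, (dirsAt j L).length ≤ L.length := fun j =>
    (List.length_map _).le.trans (List.length_filter_le _ _)
  have hfac : ∀ j, |dirDiffs (dirsAt j L) (liftM (a j) (chooseZ (t j))) (x j)| ≤
      if (dirsAt j L).length ≤ t j then Θ ^ (t j - (dirsAt j L).length) else 0 := by
    intro j
    have hcoord : |(x j - a j).valMinAbs| ≤ T := by
      rw [abs_valMinAbs_sub_eq_cycDist]; exact_mod_cast hx j
    have hcond : (|(x j - a j).valMinAbs| + (dirsAt j L).length + 1) * 2 ≤ (M : ℤ) := by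
      have : ((dirsAt j L).length : ℤ) ≤ L.length := by exact_mod_cast hℓ j
      linarith
    rw [dirDiffs_liftM_apply (a j) (chooseZ (t j)) (dirsAt j L) (x j) hcond, abs_mul, abs_pow, abs_neg, abs_one, one_pow, one_mul]
    refine (abs_iter_fwdDiff_chooseZ_le _ _ _).trans ?_
    split_ifs with h
    · refine pow_le_pow_left₀ (by positivity) ?_ _
      have hback : (((dirsAt j L).count false : ℕ) : ℝ) ≤ L.length := by
        exact_mod_cast (List.count_le_length).trans (hℓ j)
      have h1 : |((x j - a j).valMinAbs : ℝ)| ≤ T := by exact_mod_cast hcoord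
      have habs : |(((x j - a j).valMinAbs - ((dirsAt j L).count false : ℕ) : ℤ) : ℝ)| ≤ T + L.length := by
        push_cast
        refine (abs_sub _ _).trans ?_
        rw [abs_of_nonneg (by positivity : (0:ℝ) ≤ ((dirsAt j L).count false : ℕ))]
        linarith
      have htj : (t j : ℝ) ≤ tot t := by exact_mod_cast le_tot t j
      rw [hΘ]; linarith
    · exact le_rfl
  constructor
  · rw [Finset.abs_prod]
    by_cases hall : ∀ j, (dirsAt j L).length ≤ t j
    · calc ∏ j, |dirDiffs (dirsAt j L) (liftM (a j) (chooseZ (t j))) (x j)| ≤ ∏ j, Θ ^ (t j - (dirsAt j L).length) :=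
            Finset.prod_le_prod (fun j _ => abs_nonneg _) fun j _ => by have := hfac j; rwa [if_pos (hall j)] at this
        _ = Θ ^ (tot t - L.length) := by
            rw [Finset.prod_pow_eq_pow_sum, Finset.sum_tsub_distrib _ fun j _ => hall j]
            unfold tot
            rw [sum_length_dirsAt]
    · push Not at hall
      obtain ⟨j, hj⟩ := hall
      have h0 : |dirDiffs (dirsAt j L) (liftM (a j) (chooseZ (t j))) (x j)| = 0 :=
        le_antisymm (by have := hfac j; rwa [if_neg (by omega)] at this) (abs_nonneg _)
      rw [Finset.prod_eq_zero (Finset.mem_univ j) h0]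
      positivity
  · rintro ⟨j, hj⟩
    have h0 : |dirDiffs (dirsAt j L) (liftM (a j) (chooseZ (t j))) (x j)| = 0 :=
      le_antisymm (by have := hfac j; rwa [if_neg (by omega)] at this) (abs_nonneg _)
    exact Finset.prod_eq_zero (Finset.mem_univ j) (abs_eq_zero.1 h0)

/-! ### Slot products: pointwise bounds -/

omit [NeZero M] in
/-- Bound for a slot product from bounds at the actual entries. [folklore] -/
theorem abs_slotProd_le_of : ∀ (G : ℕ → TorusSite d M → ℝ) (g : ℕ → ℝ) (z : List (TorusSite d M × Fin n)),
    (∀ (k : ℕ) (hk : k < z.length), |G k (z[k]).1| ≤ g k) → |slotProd G z| ≤ ∏ k ∈ range z.length, g k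
  | G, g, [], _ => by simp
  | G, g, q :: z, h => by
      rw [slotProd_cons, abs_mul, List.length_cons, Finset.prod_range_succ', mul_comm]
      have h0 : |G 0 q.1| ≤ g 0 := h 0 (by simp)
      have hrest := abs_slotProd_le_of (fun k => G (k + 1)) (fun k => g (k + 1)) z fun k hk => by
        have := h (k + 1) (by simpa using hk); simpa using this
      exact mul_le_mul hrest h0 (abs_nonneg _) (Finset.prod_nonneg fun k hk =>
        (abs_nonneg _).trans (h (k + 1) (by simpa [Finset.mem_range] using Finset.mem_range.1 hk)) |>.trans_eq (by simp))

omit [NeZero M] in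
/-- A vanishing entry factor kills the slot product. [folklore] -/
theorem slotProd_eq_zero_of : ∀ (G : ℕ → TorusSite d M → ℝ) (z : List (TorusSite d M × Fin n)) (k : ℕ) (hk : k < z.length),
    G k (z[k]).1 = 0 → slotProd G z = 0
  | G, [], k, hk, _ => by simp at hk
  | G, q :: z, 0, _, h => by rw [slotProd_cons]; simp only [List.getElem_cons_zero] at h; rw [h, zero_mul]
  | G, q :: z, k + 1, hk, h => by
      rw [slotProd_cons, slotProd_eq_zero_of (fun k => G (k + 1)) z k (by simpa using hk) (by simpa using h), mul_zero]

/-- **Difference programmes on a slot product of multi-binomials, on a box** (`(T + |γ| + 1)·2 ≤ M`):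
with `D = Σ_{k<|z|} |ts_k|₁` and `Θ = T + |γ| + D`, `|∇^γ ∏_k mbinom_{ts_k}(z_k)| ≤ Θ^{D ∸ |γ|}`, and
the value vanishes if some slot `k < |z|` receives more than `|ts_k|₁` differences. [cite: BrydgesSlade2015RGII, Lemma 3.3.2 (lem:TayX)] -/
theorem abs_napply_slotProd_mbinom_le (a : TorusSite d M) (ts : ℕ → Fin d → ℕ) {T : ℕ} (γ : List (ℕ × (Fin d × Bool)))
    (hM : ((T : ℤ) + γ.length + 1) * 2 ≤ (M : ℤ)) (z : List (TorusSite d M × Fin n)) (hz : ∀ q ∈ z, ∀ j, cycDist (a j) (q.1 j) ≤ T) :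
    |napply (unitStep d M) γ (slotProd fun k => mbinom a (ts k)) z| ≤
      ((T : ℝ) + γ.length + (∑ k ∈ range z.length, tot (ts k) : ℕ)) ^ ((∑ k ∈ range z.length, tot (ts k)) - γ.length) ∧
    ((∃ k, k < z.length ∧ tot (ts k) < countAt k γ) → napply (unitStep d M) γ (slotProd fun k => mbinom a (ts k)) z = 0) := by
  set D := ∑ k ∈ range z.length, tot (ts k) with hD
  set Θ : ℝ := (T : ℝ) + γ.length + (D : ℕ) with hΘ
  by_cases hs : ∀ q ∈ γ, q.1 < z.length
  · rw [napply_slotProd _ γ z hs]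
    have hlenk : ∀ k, (progAt k γ).length ≤ γ.length := fun k => (List.length_map _).le.trans (List.length_filter_le _ _)
    have hMk : ∀ k, ((T : ℤ) + (progAt k γ).length + 1) * 2 ≤ (M : ℤ) := fun k => by
      have : ((progAt k γ).length : ℤ) ≤ γ.length := by exact_mod_cast hlenk k
      linarith
    have hzk : ∀ (k : ℕ) (hk : k < z.length) (j : Fin d), cycDist (a j) ((z[k]).1 j) ≤ T := fun k hk j => hz _ (List.getElem_mem hk) j
    -- per-slot consequences of `abs_fdiffs_mbinom_le`
    have hslot : ∀ (k : ℕ) (hk : k < z.length),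
        |fdiffs ((progAt k γ).map (unitStep d M)) (mbinom a (ts k)) (z[k]).1| ≤
          (if countAt k γ ≤ tot (ts k) then Θ ^ (tot (ts k) - countAt k γ) else 0) ∧
        (tot (ts k) < countAt k γ → fdiffs ((progAt k γ).map (unitStep d M)) (mbinom a (ts k)) (z[k]).1 = 0) := by
      intro k hk
      obtain ⟨hb, hv⟩ := abs_fdiffs_mbinom_le a (ts k) (progAt k γ) (hMk k) (z[k]).1 (hzk k hk)
      rw [length_progAt] at hb
      have hvan : tot (ts k) < countAt k γ → fdiffs ((progAt k γ).map (unitStep d M)) (mbinom a (ts k)) (z[k]).1 = 0 := by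
        intro hlt
        refine hv ?_
        by_contra hno
        push Not at hno
        have : countAt k γ ≤ tot (ts k) := by
          rw [← length_progAt, ← sum_length_dirsAt (progAt k γ)]
          exact Finset.sum_le_sum fun j _ => hno j
        omega
      refine ⟨?_, hvan⟩
      split_ifs with hc
      · refine hb.trans (pow_le_pow_left₀ (by positivity) ?_ _)
        have h1 : ((countAt k γ : ℕ) : ℝ) ≤ γ.length := by rw [← length_progAt]; exact_mod_cast hlenk k
        have h2 : ((tot (ts k) : ℕ) : ℝ) ≤ (D : ℕ) := by
          have : tot (ts k) ≤ D := by
            rw [hD]; exact Finset.single_le_sum (f := fun i => tot (ts i)) (fun i _ => Nat.zero_le _) (Finset.mem_range.2 hk)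
          exact_mod_cast this
        rw [hΘ]; linarith
      · push Not at hc
        rw [hvan hc, abs_zero]
    constructor
    · by_cases hall : ∀ (k : ℕ), k < z.length → countAt k γ ≤ tot (ts k)
      · refine (abs_slotProd_le_of _ (fun k => Θ ^ (tot (ts k) - countAt k γ)) z fun k hk => ?_).trans (le_of_eq ?_)
        · have := (hslot k hk).1; rwa [if_pos (hall k hk)] at this
        · rw [Finset.prod_pow_eq_pow_sum, Finset.sum_tsub_distrib _ fun k hk => hall k (Finset.mem_range.1 hk),
            sum_countAt_eq_length γ z.length hs]
      · push Not at hall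
        obtain ⟨k, hk, hlt⟩ := hall
        rw [slotProd_eq_zero_of _ z k hk ((hslot k hk).2 hlt), abs_zero]
        positivity
    · rintro ⟨k, hk, hlt⟩
      exact slotProd_eq_zero_of _ z k hk ((hslot k hk).2 hlt)
  · push Not at hs
    obtain ⟨q, hq, hqz⟩ := hs
    have h0 := napply_eq_zero_of_le_slot (slotProd fun k => mbinom a (ts k)) γ z ⟨q, hq, hqz⟩
    exact ⟨by rw [h0, abs_zero]; positivity, fun _ => h0⟩

end Loc

namespace Loc

open Finset Tphi RGNorm LocalPoly Bump Polymer Literature.Probability.LatticeModels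
open scoped ContDiff

variable {d M n : ℕ} [NeZero M]

/-! ### Structure of the dual test functions -/

/-- The count vector of a forward multi-index. [folklore] -/
def cntVec (c : Fin n × List (Fin d)) : Fin d → ℕ := fun j => c.2.count j

/-- The count vector of the `k`-th index of `m` (zero beyond the end). [folklore] -/
def cntAt (m : List (Fin n × List (Fin d))) (k : ℕ) : Fin d → ℕ := fun j => ((m.map Prod.snd).getD k []).count j

omit [NeZero M] in
/-- `cntAt` at the head. [folklore] -/
@[simp] theorem cntAt_cons_zero (c : Fin n × List (Fin d)) (m : List (Fin n × List (Fin d))) : cntAt (c :: m) 0 = cntVec c := by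
  funext j; simp [cntAt, cntVec]

omit [NeZero M] in
/-- `cntAt` on the tail. [folklore] -/
@[simp] theorem cntAt_cons_succ (c : Fin n × List (Fin d)) (m : List (Fin n × List (Fin d))) (k : ℕ) :
    cntAt (c :: m) (k + 1) = cntAt m k := by
  funext j; simp [cntAt]

omit [NeZero M] in
/-- `Σ_j count_j(l) = |l|`. [folklore] -/
theorem sum_count_eq_length : ∀ l : List (Fin d), ∑ j, l.count j = l.length
  | [] => by simp
  | i :: l => by
      simp only [List.count_cons, beq_iff_eq, Finset.sum_add_distrib, sum_count_eq_length l, List.length_cons]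
      rw [Finset.sum_ite_eq univ i (fun _ => 1)]; simp

omit [NeZero M] in
/-- `|cntVec c|₁ = |α(c)|`. [folklore] -/
theorem tot_cntVec (c : Fin n × List (Fin d)) : tot (cntVec c) = c.2.length := sum_count_eq_length c.2

omit [NeZero M] in
/-- The binomial one-point function as indicator times multi-binomial. [folklore] -/
theorem binomTF_apply (a : TorusSite d M) (c : Fin n × List (Fin d)) (y : TorusSite d M × Fin n) :
    binomTF a c y = (if y.2 = c.1 then 1 else 0) * mbinom a (cntVec c) y.1 := by
  unfold binomTF mbinom cntVec chooseZ
  split_ifs <;> simp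

/-- The component indicator of a sequence against an index list (vanishing in the wrong length). [folklore] -/
def indSeq : List (Fin n × List (Fin d)) → List (TorusSite d M × Fin n) → ℝ
  | [], [] => 1
  | c :: m, y :: z => (if y.2 = c.1 then 1 else 0) * indSeq m z
  | _, _ => 0

omit [NeZero M] in
/-- `|indSeq| ≤ 1`. [folklore] -/
theorem abs_indSeq_le_one : ∀ (m : List (Fin n × List (Fin d))) (z : List (TorusSite d M × Fin n)), |indSeq m z| ≤ 1
  | [], [] => by simp [indSeq]
  | [], _ :: _ => by simp [indSeq]
  | _ :: _, [] => by simp [indSeq]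
  | c :: m, y :: z => by
      rw [indSeq, abs_mul]
      have := abs_indSeq_le_one m z
      split_ifs <;> simp [this]

omit [NeZero M] in
/-- `indSeq` vanishes in the wrong length. [folklore] -/
theorem indSeq_eq_zero_of_length : ∀ (m : List (Fin n × List (Fin d))) (z : List (TorusSite d M × Fin n)),
    z.length ≠ m.length → indSeq m z = 0
  | [], [], h => absurd rfl h
  | [], _ :: _, _ => rfl
  | _ :: _, [], _ => rfl
  | c :: m, y :: z, h => by rw [indSeq, indSeq_eq_zero_of_length m z (by simpa using h), mul_zero]

omit [NeZero M] in
/-- `indSeq` is invariant under shifts of the points. [folklore] -/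
theorem indSeq_shiftAt (s : TorusSite d M) : ∀ (m : List (Fin n × List (Fin d))) (k : ℕ) (z : List (TorusSite d M × Fin n)),
    indSeq m (shiftAt k s z) = indSeq m z
  | m, k, [] => by simp [shiftAt]
  | [], 0, y :: z => by simp [shiftAt, indSeq]
  | [], k + 1, y :: z => by simp [shiftAt, indSeq]
  | c :: m, 0, y :: z => by simp [shiftAt, indSeq]
  | c :: m, k + 1, y :: z => by
      have ih := indSeq_shiftAt s m k z
      simp only [shiftAt, List.modify_succ_cons, indSeq] at ih ⊢
      rw [ih]

omit [NeZero M] in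
/-- **The tensor of binomial one-point functions is an indicator times a slot product of
multi-binomials.** [folklore] -/
theorem tensorTF_map_binomTF (a : TorusSite d M) :
    ∀ (m : List (Fin n × List (Fin d))) (z : List (TorusSite d M × Fin n)),
      tensorTF (m.map (binomTF a)) z = indSeq m z * slotProd (fun k => mbinom a (cntAt m k)) z
  | [], [] => by simp [indSeq]
  | [], _ :: _ => by simp [tensorTF, indSeq]
  | _ :: _, [] => by simp [tensorTF, indSeq]
  | c :: m, y :: z => by
      rw [List.map_cons, tensorTF_cons_cons, tensorTF_map_binomTF a m z, binomTF_apply, indSeq, slotProd_cons]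
      simp only [cntAt_cons_zero]
      rw [show (fun k => mbinom a (cntAt (c :: m) (k + 1))) = fun k => mbinom a (cntAt m k) from funext fun k => by rw [cntAt_cons_succ]]
      ring

omit [NeZero M] in
/-- **A shift-invariant factor passes through difference programmes.** [folklore] -/
theorem napply_mul_invariant {u : List (TorusSite d M × Fin n) → ℝ}
    (hu : ∀ (k : ℕ) (s : Fin d × Bool) (z : List (TorusSite d M × Fin n)), u (shiftAt k (unitStep d M s) z) = u z) :
    ∀ (β : List (ℕ × (Fin d × Bool))) (g : List (TorusSite d M × Fin n) → ℝ),
      napply (unitStep d M) β (fun z => u z * g z) = fun z => u z * napply (unitStep d M) β g z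
  | [], g => rfl
  | q :: β, g => by
      rw [napply_cons, napply_cons, napply_mul_invariant hu β g]
      funext z
      simp only [diffOp, hu q.1 q.2 z]
      ring

/-- The normalising constant `p!/N_m` of the dual function. [folklore] -/
def dualConst (m : List (Fin n × List (Fin d))) : ℝ := ((m.length.factorial : ℕ) : ℝ) / pcount m m

omit [NeZero M] in
/-- `p!/N_m > 0`. [folklore] -/
theorem dualConst_pos (m : List (Fin n × List (Fin d))) : 0 < dualConst m := by
  unfold dualConst
  exact div_pos (by exact_mod_cast Nat.factorial_pos _) (lt_of_lt_of_le zero_lt_one (one_le_pcount_self m))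

omit [NeZero M] in
/-- **Structure of `f_m^{(a)}`**: `f_m^{(a)}(z) = (p!/N_m)·indSeq_m(z)·∏_k mbinom_{α(m_k)}(z_k)`. [cite: BrydgesSlade2015RGII, §2.1 ((2.3)) and Lemma 2.1.2] -/
theorem dualTF_eq (a : TorusSite d M) (m : List (Fin n × List (Fin d))) :
    dualTF a m = fun z => (dualConst m * indSeq m z) * slotProd (fun k => mbinom a (cntAt m k)) z := by
  funext z
  unfold dualTF dualConst
  rw [tensorTF_map_binomTF a m z]
  ring

omit [NeZero M] in
/-- `f_m^{(a)}` is an `|m|`-variable test function. [folklore] -/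
theorem dualTF_eq_zero_of_length (a : TorusSite d M) (m : List (Fin n × List (Fin d))) (z : List (TorusSite d M × Fin n))
    (h : z.length ≠ m.length) : dualTF a m z = 0 := by
  rw [dualTF_eq]
  show dualConst m * indSeq m z * slotProd _ z = 0
  rw [indSeq_eq_zero_of_length m z h]; simp

omit [NeZero M] in
/-- The total derivative order of the dual function, `Σ_k |α(m_k)| = |α(m)|₁ = tordF m`. [folklore] -/
theorem sum_tot_cntAt (m : List (Fin n × List (Fin d))) : ∑ k ∈ range m.length, tot (cntAt m k) = tordF m := by
  unfold tordF
  induction m with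
  | nil => simp
  | cons c m ih =>
      rw [List.length_cons, Finset.sum_range_succ', List.map_cons, List.sum_cons, cntAt_cons_zero, tot_cntVec]
      simp only [cntAt_cons_succ]
      rw [ih, add_comm]

/-! ### Derivative bounds for the dual functions on box regions -/

/-- The bound function for `f_m^{(a)}`: `F(r,i) = (p!/N_m)(b + r + i + D)^{D-i}` for `i ≤ D = |α(m)|₁`, else `0`. [folklore] -/
def dualBd (m : List (Fin n × List (Fin d))) (b : ℕ) : ℕ → ℕ → ℝ :=
  fun r i => if i ≤ tordF m then dualConst m * ((b : ℝ) + r + i + tordF m) ^ (tordF m - i) else 0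

omit [NeZero M] in
/-- `dualBd ≥ 0`. [folklore] -/
theorem dualBd_nonneg (m : List (Fin n × List (Fin d))) (b r i : ℕ) : 0 ≤ dualBd m b r i := by
  unfold dualBd
  have := dualConst_pos m
  split_ifs <;> positivity

omit [NeZero M] in
/-- `dualBd` increases with the region index. [folklore] -/
theorem dualBd_mono (m : List (Fin n × List (Fin d))) (b : ℕ) {r r' : ℕ} (i : ℕ) (h : r ≤ r') : dualBd m b r i ≤ dualBd m b r' i := by
  unfold dualBd
  split_ifs with hi
  · refine mul_le_mul_of_nonneg_left (pow_le_pow_left₀ (by positivity) ?_ _) (dualConst_pos m).le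
    have : (r : ℝ) ≤ r' := by exact_mod_cast h
    linarith
  · exact le_rfl

/-- **Derivative bounds for `f_m^{(a)}` on the box regions around `a`** (budget `p_Φ`, range `r₀`,
wrap-free `(b + r₀ + p_Φ p + 1)·2 ≤ M`): `|∇^γ f_m^{(a)}(z)| ≤ dualBd(r,|γ|)` for `z ∈ boxReg a b r`,
`r ≤ r₀`. [cite: BrydgesSlade2015RGII, Lemma 3.3.2 (lem:TayX)] -/
theorem derivBdOn_dualTF (a : TorusSite d M) (m : List (Fin n × List (Fin d))) (b r₀ pΦ : ℕ)
    (hM : (((b : ℤ) + r₀) + pΦ * m.length + 1) * 2 ≤ (M : ℤ)) :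
    DerivBdOn (unitStep d M) (boxReg (n := n) a b) r₀ (fun _ => pΦ) (dualBd m b) (dualTF a m) := by
  intro r γ z hr hγ hz
  rw [dualTF_eq a m, napply_mul_invariant (u := fun z => dualConst m * indSeq m z)
    (fun k s z => by simp only [indSeq_shiftAt]) γ]
  simp only
  by_cases hzl : z.length = m.length
  · by_cases hγl : γ.length ≤ pΦ * m.length
    · have hT : (((b + r : ℕ) : ℤ) + γ.length + 1) * 2 ≤ (M : ℤ) := by
        have h1 : (γ.length : ℤ) ≤ pΦ * m.length := by exact_mod_cast hγl
        have h2 : (r : ℤ) ≤ r₀ := by exact_mod_cast hr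
        push_cast; linarith
      obtain ⟨hb, hv⟩ := abs_napply_slotProd_mbinom_le a (cntAt m) γ hT z hz
      rw [hzl, sum_tot_cntAt m] at hb
      rw [hzl] at hv
      rw [abs_mul, abs_mul, abs_of_pos (dualConst_pos m)]
      unfold dualBd
      split_ifs with hi
      · calc dualConst m * |indSeq m z| * |napply (unitStep d M) γ (slotProd fun k => mbinom a (cntAt m k)) z|
            ≤ dualConst m * 1 * (((b + r : ℕ) : ℝ) + γ.length + (tordF m : ℕ)) ^ (tordF m - γ.length) :=
              mul_le_mul (mul_le_mul_of_nonneg_left (abs_indSeq_le_one m z) (dualConst_pos m).le) hb (abs_nonneg _)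
                (by have := dualConst_pos m; positivity)
          _ = dualConst m * ((b : ℝ) + r + γ.length + tordF m) ^ (tordF m - γ.length) := by push_cast; ring
      · -- more differences than the total order: some slot is over-differentiated
        push Not at hi
        have hvan : napply (unitStep d M) γ (slotProd fun k => mbinom a (cntAt m k)) z = 0 := by
          by_cases hs : ∀ q ∈ γ, q.1 < z.length
          · refine hv ?_
            by_contra hno
            push Not at hno
            have h1 : γ.length = ∑ k ∈ range z.length, countAt k γ := (sum_countAt_eq_length γ z.length hs).symm
            rw [hzl] at h1
            have h2 : ∑ k ∈ range m.length, countAt k γ ≤ ∑ k ∈ range m.length, tot (cntAt m k) :=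
              Finset.sum_le_sum fun k hk => hno k (Finset.mem_range.1 hk)
            rw [sum_tot_cntAt] at h2
            omega
          · push Not at hs
            obtain ⟨q, hq, hqz⟩ := hs
            exact napply_eq_zero_of_le_slot _ γ z ⟨q, hq, hqz⟩
        rw [hvan, abs_zero, mul_zero]
    · rw [napply_eq_zero_of_length_lt hγ _ z (by rw [hzl]; omega), abs_mul, abs_zero, mul_zero]
      exact dualBd_nonneg m b r _
  · rw [indSeq_eq_zero_of_length m z hzl, mul_zero, zero_mul, abs_zero]
    exact dualBd_nonneg m b r _

/-! ### The `Φ`-side sum and the TayX bound -/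

/-- **`Σ_{i+j=n} C(n,i) dualBd(n,i) ρ^j R^n ≤ (p!/N_m) Θ₁^D (R/Θ₁ + ρR)^n`** with `Θ₁ = b + 2p_Φ p + D`
(`n ≤ p_Φ p`, `1 ≤ b`). [folklore] -/
theorem leibnizBd_dualBd_le (m : List (Fin n × List (Fin d))) {b : ℕ} (hb : 1 ≤ b) (pΦ : ℕ) {ρ R : ℝ} (hρ : 0 ≤ ρ) (hR : 0 ≤ R)
    {mm : ℕ} (hmm : mm ≤ pΦ * m.length) :
    leibnizBd (dualBd m b) (fun _ i => ρ ^ i) 0 mm * R ^ mm ≤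
      dualConst m * ((b : ℝ) + 2 * (pΦ * m.length) + tordF m) ^ tordF m *
        (R / ((b : ℝ) + 2 * (pΦ * m.length) + tordF m) + ρ * R) ^ mm := by
  set Θ₁ : ℝ := (b : ℝ) + 2 * (pΦ * m.length) + tordF m with hΘ₁
  have hΘ₁pos : 0 < Θ₁ := by
    have : (1 : ℝ) ≤ b := by exact_mod_cast hb
    rw [hΘ₁]; positivity
  have hκ := dualConst_pos m
  -- termwise bound on `dualBd`
  have hterm : ∀ i, i ≤ mm → dualBd m b (0 + mm) i ≤ dualConst m * Θ₁ ^ tordF m * (Θ₁⁻¹) ^ i := by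
    intro i hi
    unfold dualBd
    split_ifs with hD
    · have hbase : ((b : ℝ) + ((0 + mm : ℕ) : ℝ) + i + tordF m) ≤ Θ₁ := by
        have h1 : ((0 + mm : ℕ) : ℝ) ≤ pΦ * m.length := by push_cast; exact_mod_cast (by simpa using hmm)
        have h2 : (i : ℝ) ≤ pΦ * m.length := by exact_mod_cast hi.trans hmm
        rw [hΘ₁]; linarith
      calc dualConst m * ((b : ℝ) + ((0 + mm : ℕ) : ℝ) + i + tordF m) ^ (tordF m - i)
          ≤ dualConst m * Θ₁ ^ (tordF m - i) := mul_le_mul_of_nonneg_left (pow_le_pow_left₀ (by positivity) hbase _) hκ.le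
        _ = dualConst m * Θ₁ ^ tordF m * (Θ₁⁻¹) ^ i := by
            rw [pow_sub₀ _ hΘ₁pos.ne' hD, inv_pow]; ring
    · positivity
  unfold leibnizBd
  rw [Finset.sum_mul]
  calc ∑ ij ∈ antidiagonal mm, ((mm.choose ij.1 : ℕ) : ℝ) * (dualBd m b (0 + mm) ij.1 * ρ ^ ij.2) * R ^ mm
      ≤ ∑ ij ∈ antidiagonal mm, ((mm.choose ij.1 : ℕ) : ℝ) * (dualConst m * Θ₁ ^ tordF m * (Θ₁⁻¹) ^ ij.1 * ρ ^ ij.2) * R ^ mm := by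
        refine Finset.sum_le_sum fun ij hij => ?_
        rw [Finset.mem_antidiagonal] at hij
        have := hterm ij.1 (by omega)
        gcongr
    _ = dualConst m * Θ₁ ^ tordF m * ∑ ij ∈ antidiagonal mm, ((mm.choose ij.1 : ℕ) : ℝ) * ((R / Θ₁) ^ ij.1 * (ρ * R) ^ ij.2) := by
        rw [Finset.mul_sum]
        refine Finset.sum_congr rfl fun ij hij => ?_
        rw [Finset.mem_antidiagonal] at hij
        rw [← hij, pow_add, div_eq_mul_inv, mul_pow, mul_pow]
        ring
    _ = dualConst m * Θ₁ ^ tordF m * (R / Θ₁ + ρ * R) ^ mm := by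
        congr 1
        rw [Finset.Nat.sum_antidiagonal_eq_sum_range_succ (fun i j => ((mm.choose i : ℕ) : ℝ) * ((R / Θ₁) ^ i * (ρ * R) ^ j)) mm,
          add_pow]
        refine Finset.sum_congr rfl fun i _ => by ring

/-- The TayX constant: `N = 𝔥^{-p}(p!/N_m)Θ₁^{D} max(1, R/Θ₁ + 2R/w)^{p_Φ p}`, `Θ₁ = b + 2p_Φ p + D`,
`b = a₀ + p_Φ(w-1) + p_Φ`, `D = |α(m)|₁`. [cite: BrydgesSlade2015RGII, Lemma 3.3.2 (the constant C̄𝔥^{-m}R^{|α(m)|₁})] -/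
def tayXConst (m : List (Fin n × List (Fin d))) (a₀ w pΦ : ℕ) (𝔥 R : ℝ) : ℝ :=
  (𝔥 ^ m.length)⁻¹ * (dualConst m *
    (((a₀ + pΦ * (w - 1) + pΦ : ℕ) : ℝ) + 2 * (pΦ * m.length) + tordF m) ^ tordF m *
    (max 1 (R / (((a₀ + pΦ * (w - 1) + pΦ : ℕ) : ℝ) + 2 * (pΦ * m.length) + tordF m) + 2 / w * R)) ^ (pΦ * m.length))

/-- **[BS-rg-loc] Lemma 3.3.2 (lem:TayX) with (e:FXbd), lattice form**: for `F ∈ 𝒩(U)` with `U` in the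
box of radius `a₀` around `a` (coordinatewise cyclic distance), `|m| ≤ p_𝒩`, a cutoff width `w ≥ 1`
with its window condition, and the wrap-free condition for the visited regions,
`|⟨F, f_m^{(a)}⟩_0| ≤ N ‖F‖_{T_0(𝔥,R)}` with `N = tayXConst` — i.e. `C̄𝔥^{-p}R^{|α(m)|₁}` once
`a₀, w ≍ R` ("`‖f_m^{(a)}‖_{Φ(X)} ≤ C̄𝔥^{-m}R^{|α(m)|₁}`"). [cite: BrydgesSlade2015RGII, Lemma 3.3.2 and §2.2 (display (e:FXbd))] -/
theorem abs_TphiPairing_dualTF_le {𝔥 R : ℝ} (h𝔥 : 0 < 𝔥) (hR : 0 < R) {pΦ pN : ℕ}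
    (a : TorusSite d M) (m : List (Fin n × List (Fin d))) (hm : m.length ≤ pN)
    {a₀ w : ℕ} (ha₀ : 1 ≤ a₀) (hw : 1 ≤ w) (hwin : 2 * ((a₀ : ℤ) + pΦ * (w - 1 : ℕ)) < (M : ℤ) - 2 * pΦ)
    (hM : ((((a₀ + pΦ * (w - 1) + pΦ : ℕ) : ℤ) + pΦ * m.length) + pΦ * m.length + 1) * 2 ≤ (M : ℤ))
    {U : Finset (TorusSite d M)} (hU : ∀ x ∈ U, ∀ j, cycDist (a j) (x j) ≤ a₀)
    {F : (TorusSite d M → Fin n → ℝ) → ℝ} (hFU : DependsOn U F) (hFs : ContDiff ℝ ∞ F) :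
    |TphiPairing pN (basisDir d M n) F 0 (dualTF a m)| ≤
      tayXConst m a₀ w pΦ 𝔥 R * TphiNorm pN (latticeFamily (unitStep d M) 𝔥 R pΦ) (basisDir d M n) F 0 := by
  set b := a₀ + pΦ * (w - 1) + pΦ with hbdef
  have hb1 : 1 ≤ b := by omega
  set Θ₁ : ℝ := (b : ℝ) + 2 * (pΦ * m.length) + tordF m with hΘ₁
  set q : ℝ := R / Θ₁ + 2 / w * R with hq
  have hκ := dualConst_pos m
  have hΘ₁pos : 0 < Θ₁ := by
    have : (1 : ℝ) ≤ b := by exact_mod_cast hb1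
    rw [hΘ₁]; positivity
  have hq0 : 0 ≤ q := by rw [hq]; positivity
  have e : tayXConst m a₀ w pΦ 𝔥 R * 𝔥 ^ m.length = dualConst m * Θ₁ ^ tordF m * (max 1 q) ^ (pΦ * m.length) := by
    unfold tayXConst
    simp only [← hbdef]
    rw [mul_comm, ← mul_assoc, mul_inv_cancel₀ (pow_ne_zero _ h𝔥.ne'), one_mul]
  have hN : 0 < tayXConst m a₀ w pΦ 𝔥 R := by
    have h1 : 0 < tayXConst m a₀ w pΦ 𝔥 R * 𝔥 ^ m.length := by
      rw [e]
      have : 0 < max 1 q := lt_of_lt_of_le zero_lt_one (le_max_left _ _)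
      positivity
    exact pos_of_mul_pos_left h1 (pow_pos h𝔥 _).le |> fun h => by
      rcases lt_or_ge 0 (tayXConst m a₀ w pΦ 𝔥 R) with h' | h'
      · exact h'
      · exact absurd h1 (not_lt.2 (mul_nonpos_of_nonpos_of_nonneg h' (pow_pos h𝔥 _).le))
  refine abs_TphiPairing_le_of_local' h𝔥 hR hm hw hwin hU hFU hFs (dualTF_eq_zero_of_length a m)
    (fun r i => dualBd_nonneg m b r i) (fun r r' i h => dualBd_mono m b i h)
    (derivBdOn_dualTF a m b (pΦ * m.length) pΦ (by rw [hbdef]; exact hM)) hN fun mm hmm => ?_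
  have h1 := leibnizBd_dualBd_le m hb1 pΦ (ρ := 2 / w) (R := R) (by positivity) hR.le hmm
  rw [e]
  refine h1.trans (mul_le_mul_of_nonneg_left ?_ (by positivity))
  calc q ^ mm ≤ (max 1 q) ^ mm := pow_le_pow_left₀ hq0 (le_max_right _ _) _
    _ ≤ (max 1 q) ^ (pΦ * m.length) := pow_le_pow_right₀ (le_max_left _ _) hmm

end Loc

end LongRangePhi4

end Literature.Barriers.CriticalPhenomena
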